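/-
Copyright (c) 2026 the pub-hodgecm-mathlib formalisation cell (harness21).  Prover seat hodgecm-mathlib-F0P2-p02 (g10): road «S3-tree» (LEAD F0P3a-plan (g11) WORD T10-2;
architect A-p16 (g28∕g29) census «S3» v3 §4), brick T2 «shells ∕ fixed balls of a deep torus element», FILE 0 = THE STABILISER TEST; 2026-09-01.
The rank-`N` twin of ★ `HermitianLatticeTree.glVertexAct_glVertexAct_eq_iff_mem_glInt` (rank 2, A-p17), in the `Valued K ℤᵐ⁰` ∕ `latt` ∕ `mapGL` currency of ★ T1a.
-/
import Literature.NumberTheory.Automorphic.UnitaryLatticeTreeDual   -- ★ T1b (B-p14 (g35)) p845339: `latt_le_latt_iff`, `latt_le_stdLattice_iff`; brings ★ T1a Defs (`latt`, `mapGL`, `latticeGraphIso`, `IsIntMatrix`)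
import HarnessLib

/-!
# The stabiliser test on the lattice graph of a hermitian space: `γ · (g·𝒪^N) = g·𝒪^N ⟺ g⁻¹γg ∈ GL_N(𝒪)`, and its eigenframe reading (Serre, *Trees* II.1.1; Bruhat–Tits 1972 §10)

Topic `NumberTheory/Automorphic`; namespace `Literature.NumberTheory.Automorphic.UnitaryLatticeTree` (T1a's).  THEOREMS ONLY: no definition, no named fact, no instance, no
notation, no `sorry`.  Cell `pub/hodgecm-mathlib` (D-0151), crux H413 = `stmt-HodgeConjecture-24833`; road «S3-tree» (target `stub_N6nsS3id` of «N6nsGerm» ED. 1.15), brick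
**T2** (holder F0P2-p02, census `F0/P2/p02/g10/CENSUS-T2-DeepTorusFixedBalls.F0P2p02g10.md` 75083796f5285a30), FILE 0.  HONEST LABEL: HC_CM is proved only modulo the 2 remaining
named inputs (hLiu418 24832, h413 24833) until rung 0 closes; nothing printed is asserted here — elementary lattice algebra over a valuation ring.

THE MATHEMATICS.  For `γ, g ∈ GL_N(K)`: `γ · latt g = latt (γg)`, and `latt (γg) ≤ latt g ⟺ g⁻¹γg` integral (★ `latt_le_latt_iff`).  Hence
* §1 `mapGL_latt_le_latt_iff`: **`γ · latt g ≤ latt g′ ⟺ g′⁻¹ γ g` integral**;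
* §2 **`mapGL_latt_eq_latt_iff`: `γ · latt g = latt g ⟺ g⁻¹γg` AND `g⁻¹γ⁻¹g` integral** (i.e. `g⁻¹γg ∈ GL_N(𝒪)`) — the STABILISER TEST every shell statement of T2 (census §1 (S2), §2 (E4)),
  T3′ and T4′ starts from; in vertex form `latticeGraphIso_eq_iff`: `latticeGraphIso σ ϖ H u v = v ⟺ …` for `v.1 = latt g`, `u ∈ U(σ, H)`;
* §3 the EIGENFRAME READING `mapGL_conj_latt_mul_eq_iff`: for a torus element `γ = P δ P⁻¹` diagonalised by a frame `P` and a shell representative `x = latt (P n)`: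
  **`γ · x = x ⟺ n⁻¹ δ n` and `n⁻¹ δ⁻¹ n` integral** — the frame drops out, so T2-E's threshold law «`v(s_i − s_j) ≥ e_ij(σ)`» (census §2 (E4)) is a computation on `n⁻¹ δ n`
  alone, and T2-S's tube law is the same computation in a hyperbolic frame.  Matrix-integrality currency throughout (characteristic-free, dyadic-safe: census §3 (r3)(r4)).

## References
* [Serre1980Trees] J.-P. Serre, *Trees* (1980), Ch. II §1.1 (lattices `L = g·𝒪²`, `GL₂(𝒪)` = stabiliser of `𝒪²`, the action on lattice classes).
* [BruhatTits1972] F. Bruhat, J. Tits, *Groupes réductifs sur un corps local I*, Publ. Math. IHÉS 41 (1972), §10 (lattice models; stabilisers of vertices).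
-/

set_option autoImplicit false

noncomputable section

open scoped Valued WithZero Matrix MatrixGroups

namespace Literature.NumberTheory.Automorphic.UnitaryLatticeTree

open Literature.NumberTheory.Automorphic Literature.NumberTheory.Automorphic.HermitianLattice

variable {K : Type*} [Field K] [Valued K ℤᵐ⁰] {N : ℕ}

/-! ## §1 Inclusion after translation -/

omit [Valued K ℤᵐ⁰] in
/-- The determinant of (the matrix of) an element of `GL_N(K)` is a unit. [cite: Serre1980Trees, II.1.1] -/
theorem isUnit_det_coe (g : GL (Fin N) K) : IsUnit (g : Matrix (Fin N) (Fin N) K).det :=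
  (Matrix.isUnits_det_units g)

omit [Valued K ℤᵐ⁰] in
/-- The matrix of `g⁻¹` is the nonsingular inverse of the matrix of `g`. [cite: Serre1980Trees, II.1.1] -/
theorem coe_inv_eq_nonsing_inv (g : GL (Fin N) K) : ((g⁻¹ : GL (Fin N) K) : Matrix (Fin N) (Fin N) K) = (g : Matrix (Fin N) (Fin N) K)⁻¹ :=
  Matrix.coe_units_inv g

/-- **`γ · latt g ≤ latt g′ ⟺ g′⁻¹ γ g` is integral.** [cite: Serre1980Trees, II.1.1] -/
theorem mapGL_latt_le_latt_iff (γ g g' : GL (Fin N) K) :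
    mapGL γ (latt (g : Matrix (Fin N) (Fin N) K)) ≤ latt (g' : Matrix (Fin N) (Fin N) K) ↔
      IsIntMatrix (((g'⁻¹ * γ * g : GL (Fin N) K) : Matrix (Fin N) (Fin N) K)) := by
  rw [mapGL_latt, latt_le_latt_iff (isUnit_det_coe g'), Units.val_mul, Units.val_mul, Units.val_mul, coe_inv_eq_nonsing_inv, Matrix.mul_assoc]

/-! ## §2 The stabiliser test -/

/-- **THE STABILISER TEST: `γ · latt g = latt g ⟺ g⁻¹γg` and `g⁻¹γ⁻¹g` are integral** (`g⁻¹γg ∈ GL_N(𝒪)`; Serre: `GL₂(𝒪)` is the stabiliser of `𝒪²`).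
[cite: Serre1980Trees, II.1.1] [cite: BruhatTits1972, §10] -/
theorem mapGL_latt_eq_latt_iff (γ g : GL (Fin N) K) :
    mapGL γ (latt (g : Matrix (Fin N) (Fin N) K)) = latt (g : Matrix (Fin N) (Fin N) K) ↔
      IsIntMatrix (((g⁻¹ * γ * g : GL (Fin N) K) : Matrix (Fin N) (Fin N) K)) ∧
        IsIntMatrix (((g⁻¹ * γ⁻¹ * g : GL (Fin N) K) : Matrix (Fin N) (Fin N) K)) := by
  rw [le_antisymm_iff, mapGL_latt_le_latt_iff]
  have h2 : latt (g : Matrix (Fin N) (Fin N) K) ≤ mapGL γ (latt (g : Matrix (Fin N) (Fin N) K)) ↔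
      IsIntMatrix (((g⁻¹ * γ⁻¹ * g : GL (Fin N) K) : Matrix (Fin N) (Fin N) K)) := by
    rw [← mapGL_le_mapGL_iff γ⁻¹, ← mapGL_mul, inv_mul_cancel, mapGL_one, mapGL_latt_le_latt_iff]
  rw [h2]

/-- The two integrality conditions say `g⁻¹γg ∈ GL_N(𝒪)`: packaged as «there is an integral matrix with integral inverse conjugate to `γ` by `g`» for consumers that
prefer a witness. [cite: Serre1980Trees, II.1.1] -/
theorem mapGL_latt_eq_latt_iff_exists (γ g : GL (Fin N) K) :
    mapGL γ (latt (g : Matrix (Fin N) (Fin N) K)) = latt (g : Matrix (Fin N) (Fin N) K) ↔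
      ∃ k : GL (Fin N) K, IsIntMatrix (k : Matrix (Fin N) (Fin N) K) ∧ IsIntMatrix ((k⁻¹ : GL (Fin N) K) : Matrix (Fin N) (Fin N) K) ∧ γ = g * k * g⁻¹ := by
  rw [mapGL_latt_eq_latt_iff]
  constructor
  · rintro ⟨h1, h2⟩
    refine ⟨g⁻¹ * γ * g, h1, ?_, by group⟩
    have : (g⁻¹ * γ * g : GL (Fin N) K)⁻¹ = g⁻¹ * γ⁻¹ * g := by group
    rw [this]; exact h2
  · rintro ⟨k, hk, hk', rfl⟩
    have e1 : g⁻¹ * (g * k * g⁻¹) * g = k := by group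
    have e2 : g⁻¹ * (g * k * g⁻¹)⁻¹ * g = k⁻¹ := by group
    rw [e1, e2]
    exact ⟨hk, hk'⟩

/-- **The root vertex**: `γ · 𝒪^N = 𝒪^N ⟺ γ` and `γ⁻¹` are integral (`Stab(L₀) = GL_N(𝒪)`). [cite: Serre1980Trees, II.1.1] -/
theorem mapGL_stdLattice_eq_iff (γ : GL (Fin N) K) :
    mapGL γ (stdLattice K N) = stdLattice K N ↔
      IsIntMatrix (γ : Matrix (Fin N) (Fin N) K) ∧ IsIntMatrix ((γ⁻¹ : GL (Fin N) K) : Matrix (Fin N) (Fin N) K) := by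
  have h := mapGL_latt_eq_latt_iff γ 1
  rwa [Units.val_one, latt_one, inv_one, one_mul, mul_one, one_mul, mul_one] at h

section Vertex

variable (σ : K →+* K) (ϖ : K) (H : Matrix (Fin N) (Fin N) K)

/-- **The stabiliser test in vertex form**: for `u ∈ U(σ, H)` and a vertex `v` with underlying lattice `latt g`, `latticeGraphIso σ ϖ H u v = v ⟺ g⁻¹ug` and `g⁻¹u⁻¹g`
are integral. [cite: BruhatTits1972, §10] [cite: Serre1980Trees, II.1.1] -/
theorem latticeGraphIso_eq_iff (u : unitaryGroupOfForm σ H) (v : {M : Submodule 𝒪[K] (Fin N → K) // IsVertex σ ϖ H M}) (g : GL (Fin N) K)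
    (hv : v.1 = latt (g : Matrix (Fin N) (Fin N) K)) :
    latticeGraphIso σ ϖ H u v = v ↔
      IsIntMatrix (((g⁻¹ * (u : GL (Fin N) K) * g : GL (Fin N) K) : Matrix (Fin N) (Fin N) K)) ∧
        IsIntMatrix (((g⁻¹ * (u : GL (Fin N) K)⁻¹ * g : GL (Fin N) K) : Matrix (Fin N) (Fin N) K)) := by
  rw [← mapGL_latt_eq_latt_iff, ← hv, ← Subtype.coe_inj, latticeGraphIso_apply_coe]
  rfl

end Vertex

/-! ## §3 The eigenframe reading -/

/-- **Conjugate torus, framed shell: the frame drops out.**  For `γ = P δ P⁻¹` (a torus element diagonalised — or merely normalised — by a frame `P`) and a shell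
representative `x = latt (P n)`: `γ · x = x ⟺ n⁻¹ δ n` and `n⁻¹ δ⁻¹ n` are integral. [cite: Serre1980Trees, II.1.1] [cite: BruhatTits1972, §10] -/
theorem mapGL_conj_latt_mul_eq_iff (P δ n : GL (Fin N) K) :
    mapGL (P * δ * P⁻¹) (latt ((P * n : GL (Fin N) K) : Matrix (Fin N) (Fin N) K)) = latt ((P * n : GL (Fin N) K) : Matrix (Fin N) (Fin N) K) ↔
      IsIntMatrix (((n⁻¹ * δ * n : GL (Fin N) K) : Matrix (Fin N) (Fin N) K)) ∧
        IsIntMatrix (((n⁻¹ * δ⁻¹ * n : GL (Fin N) K) : Matrix (Fin N) (Fin N) K)) := by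
  have e1 : (P * n)⁻¹ * (P * δ * P⁻¹) * (P * n) = n⁻¹ * δ * n := by group
  have e2 : (P * n)⁻¹ * (P * δ * P⁻¹)⁻¹ * (P * n) = n⁻¹ * δ⁻¹ * n := by group
  rw [mapGL_latt_eq_latt_iff, e1, e2]

/-- **A diagonal torus element fixes every DIAGONAL shell of its frame**: for `δ = diag(s)`, `n = diag(d)` (all invertible), `n⁻¹ δ n = δ`, so `γ · latt (P n) = latt (P n)`
as soon as `δ` and `δ⁻¹` are integral — the apartment ∕ eigenframe vertices lie in `Fix(γ)` for every unit torus element (census T2 §2 (E1), (S1′)). [cite: BruhatTits1972, §10] -/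
theorem mapGL_conj_latt_mul_eq_of_diagonal (P δ n : GL (Fin N) K) (s d : Fin N → K)
    (hδ : (δ : Matrix (Fin N) (Fin N) K) = Matrix.diagonal s) (hn : (n : Matrix (Fin N) (Fin N) K) = Matrix.diagonal d)
    (hs : IsIntMatrix (δ : Matrix (Fin N) (Fin N) K)) (hs' : IsIntMatrix ((δ⁻¹ : GL (Fin N) K) : Matrix (Fin N) (Fin N) K)) :
    mapGL (P * δ * P⁻¹) (latt ((P * n : GL (Fin N) K) : Matrix (Fin N) (Fin N) K)) = latt ((P * n : GL (Fin N) K) : Matrix (Fin N) (Fin N) K) := by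
  have hcomm : n * δ = δ * n := by
    apply Units.ext
    rw [Units.val_mul, Units.val_mul, hδ, hn, Matrix.diagonal_mul_diagonal, Matrix.diagonal_mul_diagonal]
    congr 1; funext i; exact mul_comm _ _
  have e1 : n⁻¹ * δ * n = δ := by rw [mul_assoc, ← hcomm, ← mul_assoc, inv_mul_cancel, one_mul]
  have hcomm' : n * δ⁻¹ = δ⁻¹ * n := by
    calc n * δ⁻¹ = δ⁻¹ * (δ * n) * δ⁻¹ := by rw [← mul_assoc, inv_mul_cancel, one_mul]
      _ = δ⁻¹ * (n * δ) * δ⁻¹ := by rw [hcomm]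
      _ = δ⁻¹ * n := by rw [mul_assoc, mul_assoc, mul_inv_cancel, mul_one]
  have e2 : n⁻¹ * δ⁻¹ * n = δ⁻¹ := by rw [mul_assoc, ← hcomm', ← mul_assoc, inv_mul_cancel, one_mul]
  rw [mapGL_conj_latt_mul_eq_iff, e1, e2]
  exact ⟨hs, hs'⟩

end Literature.NumberTheory.Automorphic.UnitaryLatticeTree

end
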